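import Summits.HodgeConjecture.CorCM.IrreducibleOddWeightsIsotypicSlots
import Summits.HodgeConjecture.CorCM.IrreducibleOddWeightsCommutantSchur
import HarnessLib

/-!
# Isotypic cells, existence III: THE ISOTYPIC DECOMPOSITION OF A FAMILY OF SLOTS EXISTS — pairwise non-embeddable
# reference irreducibles, equivariant jointly independent embeddings spanning every slot, and components of any
# given vectors

COR-CM (cell `pub-hodgecm2`, binder seat `b16` gen 76, count-neutral claim THE ISOTYPIC DECOMPOSITION EXISTS, file
E3 — abstract `G`-set level; theorems only, no definition, no named fact, no `sorry`).  NEW as stated, hence under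
`Summits/`.  HONEST FRAMING: this is the isotypic (canonical) decomposition of the permutation modules `ℚ^{E_i}` of
finitely many finite `G`-sets, written in EXACTLY the unbundled currency that gen 75's multi-class files M1–M9
(`…MultiClass*`) take as hypotheses — so that those formulas (`dim Hg(∏_i A_i) = Σ_c r_c·dim A_c`, additivity and
sub-family domination over the commutants, the two-block defect, Hodge equivalence, the certificate) hold for EVERY
family of CM types with no input but the types (file E4).  Nothing about Hodge classes is asserted; `HC_CM` is
neither used nor asserted.

THE MASTER THEOREM (`exists_isotypic_decomposition`).  `G` any group, `E_i` (`i ∈ I` finite) finite `G`-sets,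
`V = ℚ^{⊔_i E_i}`.  There are `n : ℕ`, REFERENCES `A_c ≤ V` (`c ∈ Fin n`), MULTIPLICITIES `m_{i,c} : ℕ` and linear
`ι^i_{c,j} : V → ℚ^{E_i}` (`j ∈ Fin m_{i,c}`) such that
* every `A_c` is STABLE, IRREDUCIBLE and NON-ZERO, and the `A_c` are PAIRWISE NON-EMBEDDABLE: for `c ≠ c′` no linear
  `L : V → V` maps `A_c` into `A_{c′}` injectively and equivariantly (hypotheses `hRst`, `hRirr`, `hR0`, `hsep`);
* every `ι^i_{c,j}` is EQUIVARIANT on `A_c` (`hιeq`), and for each `(i, c)` the `ι^i_{c,j}` are JOINTLY INDEPENDENT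
  on `A_c` (`hind`: `Σ_j ι^i_{c,j}(f_j) = 0`, `f_j ∈ A_c` ⟹ all `f_j = 0`);
* in each slot the images `ι^i_{c,j}(A_c)` form an INDEPENDENT family whose `⨆` is ALL of `ℚ^{E_i}`;
* every family of vectors `u_i ∈ ℚ^{E_i}` has COMPONENTS `b^i_{c,j} ∈ A_c` with `u_i = Σ_c Σ_j ι^i_{c,j}(b^i_{c,j})`
  (hypotheses `hb`, `hu`).
PROOF.  E2: each slot subspace `V_i ≤ V` is `⨆_k M^i_k` for independent non-zero stable irreducibles; E1: the
finite family `(M^i_k)_{(i,k)}` has pairwise non-embeddable representatives `A_c = M_{rep c}` and isomorphisms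
`L_{(i,k)} : A_{cl(i,k)} ≅ M^i_k`; put `ι^i_{c,j} = res_i ∘ L_{(i,k_j)}` for an enumeration `j ↦ k_j` of the
constituents of slot `i` in class `c`; components come from `ext_i(u_i) ∈ V_i = ⨆_k M^i_k` pulled back through the
`L`'s and regrouped by class.

Also: `exists_commutants` (commutants for all references at once, gen 72 C1), `exists_mem_ne_zero_of_forall_ne_bot`
(non-zero vectors `a₀_c ∈ A_c`).

## References

* [Serre1977] J.-P. Serre, *Linear Representations of Finite Groups*, GTM 42, §1.4 Thm. 2 (complete reducibility),
  §2.2 (Schur), §2.6 (canonical decomposition), §2.7.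
* [Lang2002] S. Lang, *Algebra*, 3rd ed., XVII §1 Prop. 1.1, XVII §2 (semisimple modules), XVII §3.
* [Deligne1982HodgeCycles] P. Deligne, *Hodge cycles on abelian varieties*, LNM 900 (1982), I Ex. 3.7.
* [CurtisReiner1962] C. W. Curtis, I. Reiner, *Representation Theory of Finite Groups and Associative Algebras*, §15.
-/

set_option autoImplicit false

noncomputable section

open scoped BigOperators Classical

universe u v w

namespace Summit.HodgeConjecture.CorCM.IrrOdd

open Literature.NumberTheory.ComplexMultiplication

variable {G : Type w} [Group G] {I : Type u} {E : I → Type v} [∀ i, MulAction G (E i)] [∀ i, Fintype (E i)]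
  [Fintype I]

/-! ### §1 The master theorem -/

/-- **THE ISOTYPIC DECOMPOSITION OF A FAMILY OF SLOTS EXISTS.**  For finite `G`-sets `E_i` (`i ∈ I` finite), in
`V = ℚ^{⊔_i E_i}` there are references `A_c` (`c ∈ Fin n`), multiplicities `m_{i,c}` and linear
`ι^i_{c,j} : V → ℚ^{E_i}` (`j ∈ Fin m_{i,c}`) with: every `A_c` stable, irreducible, non-zero; the `A_c` pairwise
non-embeddable (`c ≠ c′` ⟹ no injective equivariant `A_c → A_{c′}`); every `ι^i_{c,j}` equivariant on `A_c`; for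
each `(i, c)` the `ι^i_{c,j}` jointly independent on `A_c`; in each slot the images `ι^i_{c,j}(A_c)` independent with
`⨆ = ℚ^{E_i}`; and every family of vectors `u_i ∈ ℚ^{E_i}` has components `b^i_{c,j} ∈ A_c`,
`u_i = Σ_c Σ_j ι^i_{c,j}(b^i_{c,j})` — LITERALLY the hypotheses `hRst`, `hRirr`, `hR0`, `hsep`, `hιeq`, `hind`,
`hb`, `hu` of the multi-class files (with `C = Fin n`, `Y_c = ⊔_i E_i`, `J_{i,c} = Fin m_{i,c}`).
[cite: Serre1977, §1.4 Thm. 2, §2.2 and §2.6] [cite: Lang2002, XVII §2] [cite: Deligne1982HodgeCycles, I Ex. 3.7] -/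
theorem exists_isotypic_decomposition :
    ∃ (n : ℕ) (Ar : Fin n → Submodule ℚ ((Σ i, E i) → ℚ)) (m : I → Fin n → ℕ)
      (ι : ∀ (i : I) (c : Fin n), Fin (m i c) → (((Σ i, E i) → ℚ) →ₗ[ℚ] (E i → ℚ))),
      (∀ (c : Fin n) (k : G) (a : (Σ i, E i) → ℚ), a ∈ Ar c → (fun x => a (k • x)) ∈ Ar c) ∧
      (∀ (c : Fin n) (W : Submodule ℚ ((Σ i, E i) → ℚ)), W ≤ Ar c → W ≠ ⊥ →
        (∀ (k : G) (f : (Σ i, E i) → ℚ), f ∈ W → (fun x => f (k • x)) ∈ W) → W = Ar c) ∧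
      (∀ c : Fin n, Ar c ≠ ⊥) ∧
      (∀ (c c' : Fin n) (L : ((Σ i, E i) → ℚ) →ₗ[ℚ] ((Σ i, E i) → ℚ)), c ≠ c' → Ar c ≠ ⊥ →
        (∀ a ∈ Ar c, L a ∈ Ar c') → (∀ a ∈ Ar c, L a = 0 → a = 0) →
        (∀ (k : G) (a : (Σ i, E i) → ℚ), a ∈ Ar c → L (fun x => a (k • x)) = fun x => L a (k • x)) →
        False) ∧
      (∀ (i : I) (c : Fin n) (j : Fin (m i c)) (k : G) (a : (Σ i, E i) → ℚ), a ∈ Ar c →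
        ι i c j (fun x => a (k • x)) = fun s => ι i c j a (k • s)) ∧
      (∀ (i : I) (c : Fin n) (f : Fin (m i c) → ((Σ i, E i) → ℚ)), (∀ j, f j ∈ Ar c) →
        ∑ j, ι i c j (f j) = 0 → ∀ j, f j = 0) ∧
      (∀ i : I, iSupIndep fun q : (Σ c : Fin n, Fin (m i c)) => (Ar q.1).map (ι i q.1 q.2)) ∧
      (∀ i : I, (⨆ c : Fin n, ⨆ j : Fin (m i c), (Ar c).map (ι i c j)) = ⊤) ∧
      ∀ u : ∀ i, E i → ℚ, ∃ b : ∀ (i : I) (c : Fin n), Fin (m i c) → ((Σ i, E i) → ℚ),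
        (∀ i c j, b i c j ∈ Ar c) ∧ ∀ i, u i = ∑ c, ∑ j, ι i c j (b i c j) := by
  -- operators on `V`: the translates
  let T : G → ((Σ i, E i) → ℚ) →ₗ[ℚ] ((Σ i, E i) → ℚ) := fun k => LinearMap.funLeft ℚ ℚ fun x : (Σ i, E i) => k • x
  -- E2: per-slot decompositions `V_i = ⨆_k M^i_k`
  choose n M hMle hMst hM0 hMirr hMind hMsup using fun i => exists_slot_decomposition (G := G) (E := E) i
  -- E1: representatives of the isomorphism classes of ALL constituents `(M^i_k)_{(i,k)}`
  obtain ⟨r, rep, cl, L, -, -, hsep, hL⟩ := exists_representatives T (N := fun q : (Σ i, Fin (n i)) => M q.1 q.2)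
    (fun q k f hf => hMst q.1 q.2 k f hf)
    (fun q W hW hW0 hWst => hMirr q.1 q.2 W hW hW0 fun k f hf => hWst k f hf) fun q => hM0 q.1 q.2
  -- the class-`c` constituents of slot `i`, enumerated: `j ↦ κ i c j`
  let F : I → Fin r → Type := fun i c => {k : Fin (n i) // cl ⟨i, k⟩ = c}
  let m : I → Fin r → ℕ := fun i c => Fintype.card (F i c)
  let ε : ∀ (i : I) (c : Fin r), F i c ≃ Fin (m i c) := fun i c => Fintype.equivFin (F i c)
  let κ : ∀ (i : I) (c : Fin r), Fin (m i c) → Fin (n i) := fun i c j => ((ε i c).symm j).1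
  have hκ : ∀ (i : I) (c : Fin r) (j : Fin (m i c)), cl ⟨i, κ i c j⟩ = c := fun i c j => ((ε i c).symm j).2
  have hκinj : ∀ (i : I) (c : Fin r), Function.Injective (κ i c) := fun i c j j' h =>
    (ε i c).symm.injective (Subtype.ext h)
  -- restriction to the slot and the embeddings
  let res : ∀ i : I, ((Σ i, E i) → ℚ) →ₗ[ℚ] (E i → ℚ) := fun i => LinearMap.funLeft ℚ ℚ (Sigma.mk i)
  let ιm : ∀ (i : I) (c : Fin r), Fin (m i c) → (((Σ i, E i) → ℚ) →ₗ[ℚ] (E i → ℚ)) :=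
    fun i c j => res i ∘ₗ L ⟨i, κ i c j⟩
  -- `L_{(i,k)}` is an isomorphism `A_{cl(i,k)} → M^i_k`; at a fibre element the source is `A_c`
  have key : ∀ (i : I) (c : Fin r) (j : Fin (m i c)),
      (∀ a ∈ M (rep c).1 (rep c).2, L ⟨i, κ i c j⟩ a ∈ M i (κ i c j)) ∧
      (∀ a ∈ M (rep c).1 (rep c).2, L ⟨i, κ i c j⟩ a = 0 → a = 0) ∧
      (∀ f ∈ M i (κ i c j), ∃ a ∈ M (rep c).1 (rep c).2, L ⟨i, κ i c j⟩ a = f) ∧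
      ∀ (k : G) (a : (Σ i, E i) → ℚ), a ∈ M (rep c).1 (rep c).2 →
        L ⟨i, κ i c j⟩ (fun x => a (k • x)) = fun x => L ⟨i, κ i c j⟩ a (k • x) := by
    intro i c j
    have h := hL ⟨i, κ i c j⟩
    rw [hκ i c j] at h
    exact h
  -- components of one vector of one slot
  have dec : ∀ (i : I) (u : E i → ℚ), ∃ b : ∀ c : Fin r, Fin (m i c) → ((Σ i, E i) → ℚ),
      (∀ c j, b c j ∈ M (rep c).1 (rep c).2) ∧ u = ∑ c, ∑ j, ιm i c j (b c j) := by
    intro i u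
    have hmem : slotExt (E := E) i u ∈ ⨆ k, M i k := by
      rw [hMsup i]
      exact LinearMap.mem_range_self _ _
    obtain ⟨f, hf, hfsum⟩ := exists_sum_eq_of_mem_iSup hmem
    -- pull each component back through `L_{(i,k)}`
    choose a ha hLa using fun k => (hL ⟨i, k⟩).2.2.1 (f k) (hf k)
    refine ⟨fun c j => a (κ i c j), fun c j => ?_, ?_⟩
    · have h := ha (κ i c j)
      rw [hκ i c j] at h
      exact h
    · calc u = res i (slotExt (E := E) i u) := (funLeft_sigmaMk_slotExt i u).symm
        _ = ∑ k, res i (L ⟨i, k⟩ (a k)) := by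
            rw [← hfsum, map_sum]
            exact Finset.sum_congr rfl fun k _ => by rw [hLa k]
        _ = ∑ c, ∑ j : F i c, res i (L ⟨i, j.1⟩ (a j.1)) :=
            (Fintype.sum_fiberwise (fun k : Fin (n i) => cl ⟨i, k⟩) (fun k => res i (L ⟨i, k⟩ (a k)))).symm
        _ = ∑ c, ∑ j : Fin (m i c), ιm i c j (a (κ i c j)) :=
            Finset.sum_congr rfl fun c _ =>
              ((ε i c).symm.sum_comp (fun j : F i c => res i (L ⟨i, j.1⟩ (a j.1)))).symm
  refine ⟨r, fun c => M (rep c).1 (rep c).2, m, ιm, fun c => hMst _ _, fun c => hMirr _ _, fun c => hM0 _ _,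
    fun c c' P hcc' _ h1 h2 h4 => hsep c c' P hcc' h1 h2 fun k a ha => h4 k a ha, fun i c j k a ha => ?_,
    fun i c f hf h0 => ?_, fun i => ?_, fun i => ?_, fun u => ?_⟩
  · -- equivariance of `ι^i_{c,j} = res_i ∘ L`
    show res i (L ⟨i, κ i c j⟩ (fun x => a (k • x))) = fun s => res i (L ⟨i, κ i c j⟩ a) (k • s)
    rw [(key i c j).2.2.2 k a ha]
    exact funLeft_sigmaMk_translate i k _
  · -- joint independence on `A_c`
    have hmem : ∀ j, L ⟨i, κ i c j⟩ (f j) ∈ LinearMap.range (slotExt (E := E) i) :=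
      fun j => hMle i _ ((key i c j).1 _ (hf j))
    have h1 : ∑ j, L ⟨i, κ i c j⟩ (f j) = 0 := sum_eq_zero_of_funLeft_sigmaMk_sum_eq_zero i hmem h0
    have hind : iSupIndep fun j : Fin (m i c) => M i (κ i c j) := (hMind i).comp (hκinj i c)
    have h2 := eq_zero_of_iSupIndep_of_sum_eq_zero hind (fun j => (key i c j).1 _ (hf j)) h1
    exact fun j => (key i c j).2.1 _ (hf j) (h2 j)
  · -- the images of one slot are independent
    refine (iSupIndep_iff_finsetSum_eq_zero_imp_eq_zero _).2 fun s v hv h0 => ?_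
    -- write `v q = res_i (y q)` with `y q ∈ M^i_{κ q}` for `q ∈ s` (and `y q = 0` otherwise)
    have hy : ∀ q : (Σ c : Fin r, Fin (m i c)), ∃ y : (Σ i, E i) → ℚ, y ∈ M i (κ i q.1 q.2) ∧
        (q ∈ s → res i y = v q) := by
      intro q
      by_cases hq : q ∈ s
      · obtain ⟨a, ha, hav⟩ := Submodule.mem_map.1 (hv q hq)
        exact ⟨L ⟨i, κ i q.1 q.2⟩ a, (key i q.1 q.2).1 a ha, fun _ => hav⟩
      · exact ⟨0, Submodule.zero_mem _, fun h => absurd h hq⟩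
    choose y hyM hyv using hy
    have hκ' : Function.Injective fun q : (Σ c : Fin r, Fin (m i c)) => κ i q.1 q.2 := by
      rintro ⟨c, j⟩ ⟨c', j'⟩ h
      have hcc : c = c' := by rw [← hκ i c j, ← hκ i c' j']; exact congrArg (fun k => cl ⟨i, k⟩) h
      subst hcc
      have hj : j = j' := hκinj i c h
      rw [hj]
    have hind : iSupIndep fun q : (Σ c : Fin r, Fin (m i c)) => M i (κ i q.1 q.2) := (hMind i).comp hκ'
    have hsum : ∑ q ∈ s, y q = 0 := by
      refine eq_zero_of_mem_range_slotExt i (Submodule.sum_mem _ fun q _ => hMle i _ (hyM q)) ?_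
      rw [map_sum, ← h0]
      exact Finset.sum_congr rfl fun q hq => hyv q hq
    intro q hq
    rw [← hyv q hq, (iSupIndep_iff_finsetSum_eq_zero_imp_eq_zero _).1 hind s y (fun q _ => hyM q) hsum q hq,
      map_zero]
  · -- the images span the slot
    rw [eq_top_iff]
    intro u _
    obtain ⟨b, hb, hu⟩ := dec i u
    rw [hu]
    exact Submodule.sum_mem _ fun c _ => Submodule.sum_mem _ fun j _ =>
      Submodule.mem_iSup_of_mem c (Submodule.mem_iSup_of_mem j (Submodule.mem_map_of_mem (hb c j)))
  · -- components of a family of vectors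
    choose b hb hbu using fun i => dec i (u i)
    exact ⟨b, fun i c j => hb i c j, hbu⟩

/-! ### §2 Commutants and non-zero vectors for all references -/

/-- **COMMUTANTS FOR ALL REFERENCES AT ONCE**: for any family of subspaces `A_c ≤ ℚ^{Y}` there are `𝒟_c ≤ End ℚ^{Y}`
with `L ∈ 𝒟_c ↔ L(A_c) ⊆ A_c ∧ L` commutes with the translates on `A_c` (gen 72 C1 `exists_commutant`, class by
class) — the hypothesis `h𝒟` of the multi-class files. [cite: Serre1977, §2.2] [cite: Lang2002, XVII §1 Prop. 1.1] -/
theorem exists_commutants {Y : Type v} [MulAction G Y] {C : Type*} (Ar : C → Submodule ℚ (Y → ℚ)) :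
    ∃ 𝒟 : C → Submodule ℚ ((Y → ℚ) →ₗ[ℚ] (Y → ℚ)), ∀ (c : C) (L : (Y → ℚ) →ₗ[ℚ] (Y → ℚ)),
      L ∈ 𝒟 c ↔ (∀ a ∈ Ar c, L a ∈ Ar c) ∧
        ∀ (k : G) (a : Y → ℚ), a ∈ Ar c → L (fun y => a (k • y)) = fun y => L a (k • y) := by
  choose 𝒟 h𝒟 using fun c =>
    exists_commutant (fun k : G => LinearMap.funLeft ℚ ℚ fun y : Y => k • y) (Ar c)
  exact ⟨𝒟, fun c L => h𝒟 c L⟩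

/-- Non-zero vectors `a₀_c ∈ A_c` for a family of non-zero subspaces (the `a₀` of the multi-class files). [folklore] -/
theorem exists_mem_ne_zero_of_forall_ne_bot {W : Type*} [AddCommGroup W] [Module ℚ W] {C : Type*}
    {Ar : C → Submodule ℚ W} (h0 : ∀ c, Ar c ≠ ⊥) :
    ∃ a₀ : C → W, (∀ c, a₀ c ∈ Ar c) ∧ ∀ c, a₀ c ≠ 0 := by
  choose a ha h using fun c => Submodule.exists_mem_ne_zero_of_ne_bot (h0 c)
  exact ⟨a, ha, h⟩

end Summit.HodgeConjecture.CorCM.IrrOdd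

end
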